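/-
Copyright (c) 2026 the pub-hodgecm-mathlib formalisation cell (harness21).  Prover seat hodgecm-mathlib-K2Liu-p12 (g3): Track B «K2-LIT»,
#184♮ = hLiu418 = stmt-HodgeConjecture-24832; Road I (#184♮ (σ) endgame organ), row (m1) «unimodularity of `U(V′_v)`» (LEAD F0P6-plan (g14) OWNER WORD σ18
2026-09-04T13:32:20Z; K2Liu-p11 (g2) V6-inst census 12:30:26Z (iv); K2E5-plan (g7) v3.49).  Cross-squad REUSE of ★ K2E3-p23 (g4) `K2E3RankOneUnitaryUnimodular`.
-/
import Summits.HodgeConjecture.HodgeConjecture.Theorems.K2E3RankOneUnitaryUnimodular         -- ★ E3 (FC-8): `U(σ, Φ₃)(K)` is unimodular (Cartan road) — REUSED BY NAME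
import Summits.HodgeConjecture.HodgeConjecture.Theorems.K2LiuHyperbolicFrameOfIsotropic       -- ★ (ii-gen) p07: Witt frame `[[0,1,0],[1,0,0],[0,0,a]]`
import Summits.HodgeConjecture.HodgeConjecture.Theorems.K2LiuIsotropicVectorLocal            -- ★ (ii-gen) p07: ternary hermitian spaces over `E ⊗ L⁺_v` are isotropic
import Summits.HodgeConjecture.HodgeConjecture.Theorems.K2LiuSiegelCocycleStageLong          -- ★ `conjLocal_apply_of_smul_eq`
import Literature.NumberTheory.Automorphic.UnitaryGroupNonsplitPlaceModel                    -- ★ `exists_mulEquiv_localPi_of_smul_eq` (`U(J)(F_v) ≃* U(σ_w, J_w)` at non-split `v`)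
import Literature.NumberTheory.Automorphic.UnitaryGroupFormTransport                         -- ★ `unitaryGroupOfFormCongrOfEq` (frame change as `≃ₜ*`)
import Literature.NumberTheory.Automorphic.Liu2021.FinAdelicCheckSurjective                  -- ★ `galAdicCompletionMap_galAdicCompletionMap_self`
import Literature.NumberTheory.Automorphic.AdicCompletionLocalField                           -- ★ `E_w` is a non-archimedean local field
import Literature.NumberTheory.Automorphic.ValuedFieldValuativeRelBridge                     -- ★ `valuedInteger_eq_integer`
import Literature.NumberTheory.Automorphic.AddCharConductorExponent                          -- ★ `exists_coe_valued_eq_exp_neg_one` (a uniformiser)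
import HarnessLib

/-!
# Crux `HLiu418`, Road I, row (m1): `U(V′)(L⁺_v)` IS UNIMODULAR AT A NON-SPLIT PLACE — transport of ★ E3 (FC-8) along `U(V′)(L⁺_v) ≃ₜ* U(σ_w, Φ₃)(L_w)`

Cell `hodgecm-mathlib`, crux item hLiu418 = `stmt-HodgeConjecture-24832`, route of record `HCCMUnconditional`; squad K2 ∕ K2Liu, road `K2_Liu`, #184♮ (σ) endgame
organ; consumer = V8-inst's by-value binder `[μG.IsMulRightInvariant]` (★ V8d `exists_average`, carrier ★ I-2 `K2LiuA7ValueInstanceDefs`: `G = UnitaryGroup.localPi L c 3 (diagonal dV′) v`).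
THEOREMS ONLY (no `def`, no `instance`, no `notation`, no named-fact hypothesis, no `sorry`); lane `--supports stmt-HodgeConjecture-24832` (count-neutral helper).

THE MATHEMATICS.  The content — every Haar measure on the quasi-split rank-one unitary group `U(σ, Φ₃)(K)` over a non-archimedean local field is right invariant — is
★ `K2E3RankOneUnitaryUnimodular.isMulRightInvariant_of_isHaarMeasure` (K2E3-p23, Cartan road; CITED BY NAME, not re-proved).  This file TRANSPORTS it to the K2Liu carrier
`G = U(V′)(L⁺_v) = UnitaryGroup.localPi E c 3 (diagonal d) v` (`d` real, non-zero) at a NON-SPLIT place `v` (`c • w₀ = w₀`):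
* §1 generic: right invariance pushes forward along a surjective measurable multiplicative map; proportional forms have the same unitary group; the antidiagonal form read off.
* §2 `Φ₁ : G ≃ₜ* U(σ_w, D_w)` — ★ `exists_mulEquiv_localPi_of_smul_eq` (`g ↦ g_{w₀}`, `E ⊗ L⁺_v = L_{w₀}`) made bicontinuous.
* §3 the Witt frame at `w₀`: ★ (ii-gen) `exists_isotropic_localRing` (read at `w₀`) + `exists_hyperbolic_frame_of_isotropic` ⇒ `T` with `σ(T)ᵀ D_w T = W = [[0,1,0],[1,0,0],[0,0,a]]`,
  `a = −d₀d₁d₂ ≠ 0` real; `U(σ, W) = U(σ, a⁻¹W)` and `σ(T₂)ᵀ Φ₃ T₂ = a⁻¹W` for `T₂ = [[a⁻¹,0,0],[0,0,1],[0,1,0]]` ⇒ `Φ : G ≃ₜ* U(σ_w, Φ₃)(L_{w₀})`.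
* §4 THE HEAD **`isMulRightInvariant_localPi_of_nonsplit`**: `μG` Haar on `G` ⇒ `Φ_* μG` Haar on `U(σ_w, Φ₃)` (Mathlib) ⇒ right invariant (★ E3) ⇒ `μG = Φ⁻¹_* Φ_* μG` right invariant.
The SPLIT-place head (`U ≅ GL₃(L⁺_v)`) is K2E5-p17 (g7)'s `K2LiuLocalUnitaryUnimodularSplit` (σ18 (q8)).
HONEST LABEL.  Count-neutral helper; it retires nothing by itself: `HC_CM` is proved only modulo the 7 printed citations (2 remaining named inputs:
hLiu418 = `stmt-HodgeConjecture-24832`, h413 = `stmt-HodgeConjecture-24833`) until rung 0 closes.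

## References
* [Cartier1979] P. Cartier, *Representations of p-adic groups: a survey*, PSPM 33.1 (1979): §I.3 (reductive `p`-adic groups are unimodular).
* [Folland1995] G. B. Folland, *A Course in Abstract Harmonic Analysis* (1995): §2.4 (the modular function, transport under isomorphisms).
* [PlatonovRapinchuk1994] V. Platonov, A. Rapinchuk, *Algebraic Groups and Number Theory* (1994): §2.3 (isometric forms have conjugate unitary groups), §5.1.
* [Scharlau1985HermitianForms] W. Scharlau, *Quadratic and Hermitian Forms* (1985): Ch. 7 §6 (Witt bases of hermitian spaces over local fields).
-/

set_option autoImplicit false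
-- the mandated namespace repeats the single-problem summit's segment (`HodgeConjecture.HodgeConjecture`)
set_option linter.dupNamespace false

noncomputable section

open scoped Matrix
open NumberField IsDedekindDomain Matrix MeasureTheory MeasureTheory.Measure Set
open Literature.NumberTheory.Automorphic Literature.NumberTheory.Automorphic.UnitaryGroup
open Literature.NumberTheory.GaloisRepresentations.IsNonarchimedeanLocalField

namespace Summit.HodgeConjecture.HodgeConjecture.Cruxes.HLiu418.K2LiuLocalUnitaryUnimodular

/-! ## §1 Generic letters -/

/-- **right invariance pushes forward** along a surjective measurable multiplicative map (right twin of Mathlib `isMulLeftInvariant_map`). [cite: Folland1995, §2.4] -/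
theorem isMulRightInvariant_map {G H : Type*} [Mul G] [MeasurableSpace G] [MeasurableMul G] [Mul H] [MeasurableSpace H] [MeasurableMul H]
    (μ : Measure G) [μ.IsMulRightInvariant] (f : G →ₙ* H) (hf : Measurable f) (h_surj : Function.Surjective f) :
    (Measure.map f μ).IsMulRightInvariant := by
  refine ⟨fun h => ?_⟩
  rw [map_map (measurable_mul_const _) hf]
  obtain ⟨g, rfl⟩ := h_surj h
  conv_rhs => rw [← map_mul_right_eq_self μ g]
  rw [map_map hf (measurable_mul_const _)]
  congr 2
  ext y
  simp only [Function.comp_apply, map_mul]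

/-- **proportional forms have the same unitary group**: `U(σ, a • H) = U(σ, H)` for `a ≠ 0` (over a field). [cite: PlatonovRapinchuk1994, §2.3] -/
theorem unitaryGroupOfForm_smul {K : Type*} [Field K] {n : Type*} [Fintype n] [DecidableEq n] (σ : K →+* K) (H : Matrix n n K) {a : K} (ha : a ≠ 0) :
    unitaryGroupOfForm σ (a • H) = unitaryGroupOfForm σ H := by
  ext g
  rw [mem_unitaryGroupOfForm_iff, mem_unitaryGroupOfForm_iff, Matrix.mul_smul, Matrix.smul_mul]
  exact (smul_right_injective (Matrix n n K) ha).eq_iff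

/-- two subgroups of a topological group that coincide are isomorphic topological groups (the identity on elements). [folklore] -/
theorem exists_continuousMulEquiv_of_eq {G : Type*} [Group G] [TopologicalSpace G] {H K : Subgroup G} (h : H = K) :
    ∃ e : H ≃ₜ* K, ∀ x : H, ((e x : K) : G) = (x : G) := by
  subst h
  exact ⟨ContinuousMulEquiv.refl H, fun _ => rfl⟩

/-- the entries of Mok's antidiagonal form `Φ₃` over `K`: `Φ₃ i j = [j = rev i]`. [cite: PlatonovRapinchuk1994, §2.3] -/
theorem antidiagonal_over_apply {K : Type*} [CommRing K] (i j : Fin 3) : (StdForm.antidiagonal 3).over K i j = if j = i.rev then 1 else 0 := by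
  simp only [StdForm.over, StdForm.antidiagonal, Matrix.map_apply, Matrix.of_apply]
  split_ifs <;> simp

/-- **the last frame change**: for `a ≠ 0` fixed by `σ`, `T₂ = [[a⁻¹,0,0],[0,0,1],[0,1,0]]` satisfies `σ(T₂)ᵀ · Φ₃ · T₂ = a⁻¹ • [[0,1,0],[1,0,0],[0,0,a]]`.
[cite: PlatonovRapinchuk1994, §2.3] [cite: Scharlau1985HermitianForms, Ch. 7 §6] -/
theorem transpose_T₂_mul_antidiagonal_mul_T₂ {K : Type*} [Field K] (σ : K →+* K) {a : K} (ha : a ≠ 0) (hσa : σ a = a) :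
    ((!![a⁻¹, 0, 0; 0, 0, 1; 0, 1, 0] : Matrix (Fin 3) (Fin 3) K).map σ)ᵀ * (StdForm.antidiagonal 3).over K * !![a⁻¹, 0, 0; 0, 0, 1; 0, 1, 0] =
      a⁻¹ • (!![0, 1, 0; 1, 0, 0; 0, 0, a] : Matrix (Fin 3) (Fin 3) K) := by
  have hσa' : σ a⁻¹ = a⁻¹ := by rw [map_inv₀, hσa]
  ext i j
  fin_cases i <;> fin_cases j <;>
    simp [Matrix.mul_apply, Fin.sum_univ_three, antidiagonal_over_apply, hσa', Fin.rev, ha]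

/-! ## §2 `U(J)(F_v) ≃ₜ* U(σ_{w₀}, J_{w₀})(E_{w₀})` at a non-split place -/

section Place

variable (F : Type) [Field F] [NumberField F] (E : Type) [Field E] [NumberField E] [Algebra F E] [Algebra.IsQuadraticExtension F E]
  (c : E ≃ₐ[F] E) (hc : c ≠ 1) {v : HeightOneSpectrum (𝓞 F)} (w₀ : PlacesOver E v) (hw₀ : c • w₀.1 = w₀.1)

include hc in
/-- **`U(J)(F_v) ≃ₜ* U(σ_{w₀}, J_{w₀})(E_{w₀})`, `g ↦ g_{w₀}`, at a NON-SPLIT place** (★ `exists_mulEquiv_localPi_of_smul_eq` made bicontinuous: evaluation at the unique `w₀ ∣ v`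
and its inverse are continuous for the product topology with one factor). [cite: PlatonovRapinchuk1994, §5.1] -/
theorem exists_continuousMulEquiv_localPi_of_smul_eq {N : ℕ} (J : Matrix (Fin N) (Fin N) E) :
    ∃ e : UnitaryGroup.localPi E c N J v ≃ₜ* unitaryGroupOfForm (galAdicCompletionMap (L := E) c hw₀) (placeForm J w₀.1),
      ∀ g : UnitaryGroup.localPi E c N J v,
        ((e g : unitaryGroupOfForm (galAdicCompletionMap (L := E) c hw₀) (placeForm J w₀.1)) : GL (Fin N) (w₀.1.adicCompletion E)) =
          (g : UnitaryGroup.LocalGLPi E N v) w₀ := by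
  haveI : Subsingleton (PlacesOver E v) := PlacesOver.subsingleton_of_smul_eq c hc w₀ hw₀
  obtain ⟨e, he, -⟩ := exists_mulEquiv_localPi_of_smul_eq c N J hc w₀ hw₀
  have hcont : Continuous e := by
    refine continuous_induced_rng.2 ?_
    have h1 : (Subtype.val ∘ e) = fun g : UnitaryGroup.localPi E c N J v => (g : UnitaryGroup.LocalGLPi E N v) w₀ := funext he
    rw [h1]
    exact (continuous_apply w₀).comp continuous_subtype_val
  have hcont' : Continuous e.symm := by
    refine continuous_induced_rng.2 (continuous_pi fun w => ?_)
    obtain rfl : w = w₀ := Subsingleton.elim _ _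
    have h1 : (fun u => ((Subtype.val ∘ e.symm) u) w) =
        fun u : ↥(unitaryGroupOfForm (galAdicCompletionMap (L := E) c hw₀) (placeForm J w.1)) => (u : GL (Fin N) (w.1.adicCompletion E)) := by
      funext u
      rw [Function.comp_apply, ← he, MulEquiv.apply_symm_apply]
    rw [h1]
    exact continuous_subtype_val
  exact ⟨{ e with continuous_toFun := hcont, continuous_invFun := hcont' }, he⟩

end Place

/-! ## §3 The Witt frame at `w₀` and `U(V′)(L⁺_v) ≃ₜ* U(σ_{w₀}, Φ₃)(L_{w₀})` -/

section Frame

variable (F : Type) [Field F] [NumberField F] (E : Type) [Field E] [NumberField E] [Algebra F E] [Algebra.IsQuadraticExtension F E]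
  (c : E ≃ₐ[F] E) (hc : c ≠ 1) (hcc : c * c = 1) {δ : E} (hcδ : c δ = -δ) (hδ : δ ≠ 0) {θ : F} (hθ : δ * δ = algebraMap F E θ)
  {v : HeightOneSpectrum (𝓞 F)} (w₀ : PlacesOver E v) (hw₀ : c • w₀.1 = w₀.1)
  (d : Fin 3 → F) (hd0 : ∀ k, d k ≠ 0) {dE : Fin 3 → E} (hdE : ∀ k, algebraMap F E (d k) = dE k)

include hcδ hδ hθ hc hdE in
/-- **AN ISOTROPIC VECTOR AT `w₀`**: the ternary hermitian space `diag(d)` over `E_{w₀}` has `u ≠ 0` with `Σ d_k u_k σ(u_k) = 0` (★ (ii-gen) `exists_isotropic_localRing` over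
`E ⊗ L⁺_v`, read at the unique place `w₀`). [cite: Scharlau1985HermitianForms, Ch. 7 §6] -/
theorem exists_isotropic_at :
    ∃ u : Fin 3 → w₀.1.adicCompletion E, u ≠ 0 ∧
      ∑ k, ((dE k : E) : w₀.1.adicCompletion E) * u k * galAdicCompletionMap (L := E) c hw₀ (u k) = 0 := by
  obtain ⟨y, hy0, hy⟩ := K2LiuIsotropicVectorLocal.exists_isotropic_localRing (σ := c) hcδ hδ hθ v (fun k => ((d k : F) : v.adicCompletion F))
  refine ⟨fun k => y k w₀, fun hu => hy0 (funext fun k => ?_), ?_⟩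
  · exact (LocalRing.eq_iff_apply_eq c hc w₀ hw₀ (y k) 0).2 (by rw [Pi.zero_apply]; exact congrFun hu k)
  · have h := congrFun hy w₀
    rw [Finset.sum_apply, Pi.zero_apply] at h
    rw [← h]
    refine Finset.sum_congr rfl fun k _ => ?_
    rw [Pi.mul_apply, Pi.mul_apply, toLocalRing_apply, toPlace_coe, hdE,
      K2LiuSiegelCocycleStageLong.conjLocal_apply_of_smul_eq F E c v (y k) w₀ w₀ hw₀]

include hcδ hδ hθ hc hcc hd0 hdE in
/-- **`U(V′)(L⁺_v) ≃ₜ* U(σ_{w₀}, Φ₃)(L_{w₀})` AT A NON-SPLIT PLACE** for `V′ = diag(d)`, `d` real non-zero: §2's evaluation, then the Witt frame of ★ (ii-gen)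
(`σ(T)ᵀ·diag(d)·T = W = [[0,1,0],[1,0,0],[0,0,a]]`, `a = −d₀d₁d₂`), `U(σ,W) = U(σ,a⁻¹W)`, and `σ(T₂)ᵀ Φ₃ T₂ = a⁻¹W`. [cite: Scharlau1985HermitianForms, Ch. 7 §6]
[cite: PlatonovRapinchuk1994, §2.3, §5.1] -/
theorem nonempty_continuousMulEquiv_antidiagonal :
    Nonempty (UnitaryGroup.localPi E c 3 (Matrix.diagonal dE) v ≃ₜ*
      unitaryGroupOfForm (galAdicCompletionMap (L := E) c hw₀) ((StdForm.antidiagonal 3).over (w₀.1.adicCompletion E))) := by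
  -- letters at `K := E_{w₀}`, `σ := c_{w₀}`
  haveI : CharZero (w₀.1.adicCompletion E) := charZero_of_injective_algebraMap (algebraMap E _).injective
  have hσσ : ∀ x, galAdicCompletionMap (L := E) c hw₀ (galAdicCompletionMap (L := E) c hw₀ x) = x :=
    Liu2021.galAdicCompletionMap_galAdicCompletionMap_self F E c hcc hw₀
  have hd' : ∀ k, galAdicCompletionMap (L := E) c hw₀ ((dE k : E) : w₀.1.adicCompletion E) = ((dE k : E) : w₀.1.adicCompletion E) := by
    intro k
    rw [galAdicCompletionMap_coe, AlgEquiv.smul_def, ← hdE, AlgEquiv.commutes]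
  have hcoe : ∀ x : E, ((x : E) : w₀.1.adicCompletion E) = algebraMap E (w₀.1.adicCompletion E) x := fun x => rfl
  have hd'0 : ∀ k, ((dE k : E) : w₀.1.adicCompletion E) ≠ 0 := fun k => by
    rw [hcoe, ← hdE, ne_eq, map_eq_zero_iff _ (algebraMap E _).injective, map_eq_zero_iff _ (algebraMap F E).injective]; exact hd0 k
  have ht₀ : (2⁻¹ : w₀.1.adicCompletion E) + galAdicCompletionMap (L := E) c hw₀ 2⁻¹ = 1 := by
    rw [map_inv₀, map_ofNat, ← two_mul, mul_inv_cancel₀ two_ne_zero]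
  -- §2: evaluation at `w₀`
  obtain ⟨Φ₁, -⟩ := exists_continuousMulEquiv_localPi_of_smul_eq F E c hc w₀ hw₀ (Matrix.diagonal dE)
  have hD : placeForm (Matrix.diagonal dE) w₀.1 = Matrix.diagonal fun k => ((dE k : E) : w₀.1.adicCompletion E) := by
    rw [placeForm, Matrix.diagonal_map (map_zero _)]; rfl
  -- §3: the Witt frame
  obtain ⟨u, hu0, huu⟩ := exists_isotropic_at F E c hc hcδ hδ hθ w₀ hw₀ d hdE
  obtain ⟨P, hP1, hPW⟩ := K2LiuHyperbolicFrameOfIsotropic.exists_hyperbolic_frame_of_isotropic (galAdicCompletionMap (L := E) c hw₀)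
    (fun k => ((dE k : E) : w₀.1.adicCompletion E)) hσσ hd' hd'0 ht₀ hu0 huu
  set a : w₀.1.adicCompletion E := -(((dE 0 : E) : w₀.1.adicCompletion E) * ((dE 1 : E) : w₀.1.adicCompletion E) * ((dE 2 : E) : w₀.1.adicCompletion E)) with ha_def
  have ha : a ≠ 0 := neg_ne_zero.2 (mul_ne_zero (mul_ne_zero (hd'0 0) (hd'0 1)) (hd'0 2))
  have hσa : galAdicCompletionMap (L := E) c hw₀ a = a := by rw [ha_def, map_neg, map_mul, map_mul, hd', hd', hd']
  have hTdet : ((P.map (galAdicCompletionMap (L := E) c hw₀))ᵀ).det ≠ 0 := by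
    rw [Matrix.det_transpose, ← RingHom.mapMatrix_apply, ← RingHom.map_det, hP1, map_one]; exact one_ne_zero
  have hTW : formCongr (galAdicCompletionMap (L := E) c hw₀) (Matrix.GeneralLinearGroup.mkOfDetNeZero _ hTdet) (placeForm (Matrix.diagonal dE) w₀.1) =
      !![0, 1, 0; 1, 0, 0; 0, 0, a] := by
    have hσσ' : (⇑(galAdicCompletionMap (L := E) c hw₀) ∘ ⇑(galAdicCompletionMap (L := E) c hw₀)) = id := funext hσσ
    rw [formCongr, hD, ← hPW, Matrix.diagonal_transpose]
    change ((((P.map (galAdicCompletionMap (L := E) c hw₀))ᵀ).map (galAdicCompletionMap (L := E) c hw₀))ᵀ) * _ * (P.map (galAdicCompletionMap (L := E) c hw₀))ᵀ = _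
    rw [Matrix.transpose_map, Matrix.map_map, hσσ', Matrix.map_id, Matrix.transpose_transpose]
  let Φ₂ := (unitaryGroupOfFormCongrOfEq (galAdicCompletionMap (L := E) c hw₀) (Matrix.GeneralLinearGroup.mkOfDetNeZero _ hTdet)
    (placeForm (Matrix.diagonal dE) w₀.1) _ hTW).symm
  -- `U(σ, W) = U(σ, a⁻¹ W)`
  obtain ⟨Φ₃, -⟩ := exists_continuousMulEquiv_of_eq (unitaryGroupOfForm_smul (galAdicCompletionMap (L := E) c hw₀) (!![0, 1, 0; 1, 0, 0; 0, 0, a]) (inv_ne_zero ha)).symm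
  -- the last frame change
  have hT₂det : (!![a⁻¹, 0, 0; 0, 0, 1; 0, 1, 0] : Matrix (Fin 3) (Fin 3) (w₀.1.adicCompletion E)).det ≠ 0 := by
    simp [Matrix.det_fin_three, ha]
  have hT₂ : formCongr (galAdicCompletionMap (L := E) c hw₀) (Matrix.GeneralLinearGroup.mkOfDetNeZero _ hT₂det) ((StdForm.antidiagonal 3).over (w₀.1.adicCompletion E)) =
      a⁻¹ • !![0, 1, 0; 1, 0, 0; 0, 0, a] :=
    transpose_T₂_mul_antidiagonal_mul_T₂ (galAdicCompletionMap (L := E) c hw₀) ha hσa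
  let Φ₄ := unitaryGroupOfFormCongrOfEq (galAdicCompletionMap (L := E) c hw₀) (Matrix.GeneralLinearGroup.mkOfDetNeZero _ hT₂det)
    ((StdForm.antidiagonal 3).over (w₀.1.adicCompletion E)) _ hT₂
  exact ⟨Φ₁.trans (Φ₂.trans (Φ₃.trans Φ₄))⟩

end Frame

/-! ## §4 THE HEAD: every Haar measure on `U(V′)(L⁺_v)` is right invariant at a non-split place -/

section Head

variable (F : Type) [Field F] [NumberField F] (E : Type) [Field E] [NumberField E] [Algebra F E] [Algebra.IsQuadraticExtension F E]
  (c : E ≃ₐ[F] E) (hc : c ≠ 1) (hcc : c * c = 1) {δ : E} (hcδ : c δ = -δ) (hδ : δ ≠ 0) {θ : F} (hθ : δ * δ = algebraMap F E θ)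
  {v : HeightOneSpectrum (𝓞 F)} (w₀ : PlacesOver E v) (hw₀ : c • w₀.1 = w₀.1)
  (d : Fin 3 → F) (hd0 : ∀ k, d k ≠ 0) {dE : Fin 3 → E} (hdE : ∀ k, algebraMap F E (d k) = dE k)

include hcδ hδ hθ hc hcc hd0 hdE w₀ hw₀ in
/-- **`U(V′)(L⁺_v)` IS UNIMODULAR AT A NON-SPLIT PLACE (m1)**: for `V′ = diag(d)` (`d` real non-zero) and `c • w₀ = w₀`, every Haar measure `μG` on
`G = UnitaryGroup.localPi E c 3 (diagonal d) v` is right invariant — `Φ_* μG` is a Haar measure on `U(σ_{w₀}, Φ₃)(L_{w₀})` (§3's `Φ`), right invariant by ★ E3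
`K2E3RankOneUnitaryUnimodular.isMulRightInvariant_of_isHaarMeasure` (Cartan road), and `μG = Φ⁻¹_* Φ_* μG`.  The `[μG.IsMulRightInvariant]` binder of ★ V8d `exists_average`.
[cite: Cartier1979, §I.3] [cite: Folland1995, §2.4] [cite: PlatonovRapinchuk1994, §2.3] -/
theorem isMulRightInvariant_localPi_of_nonsplit
    [MeasurableSpace (UnitaryGroup.localPi E c 3 (Matrix.diagonal dE) v)] [BorelSpace (UnitaryGroup.localPi E c 3 (Matrix.diagonal dE) v)]
    [SecondCountableTopology (UnitaryGroup.localPi E c 3 (Matrix.diagonal dE) v)] [LocallyCompactSpace (UnitaryGroup.localPi E c 3 (Matrix.diagonal dE) v)]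
    (μG : Measure (UnitaryGroup.localPi E c 3 (Matrix.diagonal dE) v)) [μG.IsHaarMeasure] : μG.IsMulRightInvariant := by
  obtain ⟨Φ⟩ := nonempty_continuousMulEquiv_antidiagonal F E c hc hcc hcδ hδ hθ w₀ hw₀ d hd0 hdE
  borelize ↥(unitaryGroupOfForm (galAdicCompletionMap (L := E) c hw₀) ((StdForm.antidiagonal 3).over (w₀.1.adicCompletion E)))
  haveI : SecondCountableTopology ↥(unitaryGroupOfForm (galAdicCompletionMap (L := E) c hw₀) ((StdForm.antidiagonal 3).over (w₀.1.adicCompletion E))) :=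
    Φ.symm.toHomeomorph.secondCountableTopology
  haveI : LocallyCompactSpace ↥(unitaryGroupOfForm (galAdicCompletionMap (L := E) c hw₀) ((StdForm.antidiagonal 3).over (w₀.1.adicCompletion E))) :=
    Φ.toHomeomorph.locallyCompactSpace_iff.1 inferInstance
  haveI : CharZero (w₀.1.adicCompletion E) := charZero_of_injective_algebraMap (algebraMap E _).injective
  haveI : CompactSpace (Valued.integer (w₀.1.adicCompletion E)) := by rw [valuedInteger_eq_integer]; infer_instance
  have hσσ : ∀ x, galAdicCompletionMap (L := E) c hw₀ (galAdicCompletionMap (L := E) c hw₀ x) = x :=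
    Liu2021.galAdicCompletionMap_galAdicCompletionMap_self F E c hcc hw₀
  have hσv : ∀ x, Valued.v (galAdicCompletionMap (L := E) c hw₀ x) = Valued.v x := fun x => valued_galAdicCompletionMap (L := E) c hw₀ x
  obtain ⟨π, -, hπ⟩ := exists_coe_valued_eq_exp_neg_one w₀.1
  have hR : (μG.map Φ).IsMulRightInvariant :=
    Summit.HodgeConjecture.HodgeConjecture.Cruxes.H413.K2E3RankOneUnitaryUnimodular.isMulRightInvariant_of_isHaarMeasure
      (galAdicCompletionMap (L := E) c hw₀) rfl hσσ hσv hπ two_ne_zero three_ne_zero _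
  have hback : μG = (μG.map Φ).map Φ.symm := (Φ.toHomeomorph.toMeasurableEquiv.map_symm_map (μ := μG)).symm
  rw [hback]
  exact isMulRightInvariant_map _ Φ.symm.toMulEquiv.toMulHom Φ.symm.continuous.measurable Φ.symm.surjective

end Head

end Summit.HodgeConjecture.HodgeConjecture.Cruxes.HLiu418.K2LiuLocalUnitaryUnimodular

end
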